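import Summits.KontsevichZagierPeriods.KontsevichZagierPeriods.Theses.DimensionBudget
import Literature.NumberTheory.Transcendental.KZRelationsLE

/-!
# `Exhaustion` (stmt-KontsevichZagierPeriods-3752, route DimensionBudget) — proof

The dimension filtration exhausts the relations of the Kontsevich–Zagier calculus:
`KZ.relations = ⨆_d closure (moves ∩ ⟨representations of dimension ≤ d⟩)`, where "moves" is the
union of the four move sets (rules (1a), (1b), (2), (3)) and `⟨…⟩` the subgroup of `KZ.FormalRep`
generated by the `[s]` with `dim s ≤ d`.

Proof: pure algebra, already in the tree as `KZ.relations_eq_iSup_relationsLE`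
(`KZRelationsLE.lean`), whose right-hand side `⨆ d, KZ.relationsLE d` unfolds definitionally
(`KZ.relationsLE d = closure (KZ.movesLE d)`, `KZ.movesLE d = moves ∩ KZ.formalRepLE d`,
`KZ.formalRepLE d = closure {x | ∃ k s, k ≤ d ∧ x = [s]}`) to the item's right-hand side: (≥) each
truncated closure lies in `KZ.relations` by `AddSubgroup.closure_mono`; (≤) every move generator is
supported in the dimensions of its two or three representations, hence lies in some level.
-/

noncomputable section

open Literature.NumberTheory.Transcendental

namespace Summit.KontsevichZagierPeriods.DimensionBudget

/-- **`Exhaustion`** (route DimensionBudget, stmt-KontsevichZagierPeriods-3752):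
`KZ.relations = ⨆_d closure (moves ∩ closure {[s] | dim s ≤ d})`. This is
`KZ.relations_eq_iSup_relationsLE` after unfolding `KZ.relationsLE`, `KZ.movesLE`, `KZ.formalRepLE`.
[cite: KontsevichZagier2001, §1.2] -/
theorem exhaustion_proof :
    Summit.KontsevichZagierPeriods.KontsevichZagierPeriods.Theses.DimensionBudget.Exhaustion :=
  KZ.relations_eq_iSup_relationsLE

end Summit.KontsevichZagierPeriods.DimensionBudget

end
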